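import Summits.CriticalPhenomena.PercolationContinuityZ3.Theorems.PercNearOneGluingNoHeavyLowerTailSahiTwoChainFKGCoupling
import HarnessLib

/-!
# Sahi's conjecture for FKG measures on a product of two chains, II: **`E_n ≥ 0` for every FKG weight on `α × β`, every `n`**

Support file of the one-cut programme (crux `NoHeavyLowerTail`, stmt-CriticalPhenomena-4575; cell `prim-masterthm`, seat P3, gen 16;
`run/shared/lean/prim/prim-masterthm/prim-masterthm-p3/HIERARCHY.md` §24; memo
`run/shared/lean/prim/prim-masterthm/FROM-prim-masterthm-p3-g16-TWO-CHAIN-COEFFICIENTS.md` §6).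

**`sahiPositive_of_isFKGMeasure_prod`**: for finite chains `α, β` (`β` nonempty) and a probability weight `μ` on `α × β` satisfying the FKG
lattice condition (`IsFKGMeasure μ`), `SahiPositive μ n` for EVERY `n`: `E_n^μ(f_0,…,f_{n−1}) ≥ 0` for all nonnegative monotone `f_i`.
This is Sahi's Conjecture 5 [Sahi2008; LiebSahi2021, Conj. 1.1] for ALL two-dimensional FKG posets `α × β` — Lieb–Sahi's Theorem 3.7
[LiebSahi2021] is the case of product weights.  PROOF.  By `…FKGCoupling` the quantile coupling `(x,k) ↦ (x, quantile_k(x))` from the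
product of chains `PosRow μ × Fin N` (weight: row mass ⊗ uniform) is MONOTONE (`latentMap_monotone`) because the conditionals are
stochastically increasing; its push-forward `μ_N` has `E_n ≥ 0` (`sahiE_approxMeasure_nonneg`: `sahiE_pushWeight` + Lieb–Sahi for the product
weight, `ProductChains.sahiPositive_prodWeight_linearOrder`, applied to the monotone pulled-back family); `μ_N(x,y) =
μ(row x)(⌊N F(y|x)⌋ − ⌊N F(<y|x)⌋)/N → μ(x,y)` (`tendsto_approxMeasure`); and `E_n` is continuous in the weight (`BHK2006.continuous_sahiE`).
HONEST FRAMING: Sahi's conjecture for FKG posets of higher dimension (e.g. `{0,1}^k`, `k ≥ 3`, product measures = Kahn's question) remains OPEN.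
Everything PROVED, standard axioms; no new definitions. [this work]
-/

noncomputable section

open scoped Classical
open Filter Topology

namespace Summit.CriticalPhenomena.PercolationContinuityZ3.Theorems

open Finset Function
open Literature.Combinatorics.Sahi2008

namespace SahiTwoChain

section FKG

variable {α β : Type*} [LinearOrder β] [Fintype β]

variable {μ : α × β → ℝ}

/-- **The coupling map is monotone** (for an FKG measure). [this work] -/
theorem latentMap_monotone [LinearOrder α] [Fintype α] [Nonempty β] (hμ : IsFKGMeasure μ) (N : ℕ) :
    Monotone (latentMap μ N) := by
  intro p q hpq
  have h1 : p.1 ≤ q.1 := hpq.1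
  have h2 : p.2 ≤ q.2 := hpq.2
  refine ⟨(show p.1.1 ≤ q.1.1 from h1), ?_⟩
  show quantile μ N p.1.1 p.2 ≤ quantile μ N q.1.1 q.2
  exact (quantile_mono_level hμ.nonneg (show (p.2 : ℕ) ≤ q.2 from h2) q.2.isLt p.1.2).trans
    (quantile_mono_row hμ q.2.isLt (show p.1.1 ≤ q.1.1 from h1) p.1.2 q.1.2)

/-- **The value of the approximating measure**: `μ_N(x,y) = μ(row x)·#{k : quantile_k(x) = y}/N` (and `0` on rows of mass `0`).
[this work] -/
theorem approxMeasure_apply [Fintype α] [Nonempty β] (N : ℕ) (x : α) (y : β) :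
    approxMeasure μ N (x, y) = if 0 < rowMass μ x then
      rowMass μ x * (((univ.filter fun k : Fin N => quantile μ N x k = y).card : ℝ) / N) else 0 := by
  unfold approxMeasure
  rw [pushWeight_apply, Fintype.sum_prod_type]
  by_cases hx : 0 < rowMass μ x
  · rw [if_pos hx]
    rw [Finset.sum_eq_single (⟨x, hx⟩ : PosRow μ)]
    · -- the row `x` itself
      have hterm : ∀ k : Fin N, (if latentMap μ N (⟨x, hx⟩, k) = (x, y) then latentWeight μ N (⟨x, hx⟩, k) else 0) =
          if quantile μ N x k = y then rowMass μ x * (1 / (N : ℝ)) else 0 := by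
        intro k
        simp only [latentMap, latentWeight, Prod.mk.injEq, true_and]
      simp only [hterm]
      rw [← Finset.sum_filter, Finset.sum_const, nsmul_eq_mul]
      ring
    · intro x' _ hx'
      refine Finset.sum_eq_zero fun k _ => ?_
      rw [if_neg]
      intro h
      apply hx'
      have h1 : x'.1 = x := (Prod.mk.inj h).1
      exact Subtype.ext h1
    · intro h
      exact absurd (mem_univ _) h
  · rw [if_neg hx]
    refine Finset.sum_eq_zero fun x' _ => Finset.sum_eq_zero fun k _ => ?_
    rw [if_neg]
    intro h
    have h1 : x'.1 = x := (Prod.mk.inj h).1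
    exact hx (h1 ▸ x'.2)

/-- The count of levels hitting a point, as a difference of the two cumulative counts. [this work] -/
theorem card_quantile_eq [Nonempty β] (N : ℕ) (x : α) (y : β) :
    ((univ.filter fun k : Fin N => quantile μ N x k = y).card : ℝ) =
      ((univ.filter fun k : Fin N => quantile μ N x k ≤ y).card : ℝ) -
        ((univ.filter fun k : Fin N => quantile μ N x k < y).card : ℝ) := by
  rw [eq_sub_iff_add_eq]
  norm_cast
  rw [← Finset.card_union_of_disjoint]
  · congr 1
    ext k
    simp only [Finset.mem_union, Finset.mem_filter, Finset.mem_univ, true_and, le_iff_eq_or_lt]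
  · rw [Finset.disjoint_filter]
    intro k _ h
    exact not_lt.2 h.ge

/-- **The approximating measures converge to `μ`** pointwise. [this work] -/
theorem tendsto_approxMeasure [Fintype α] [Nonempty β] (hμ0 : ∀ p, 0 ≤ μ p) (x : α) (y : β) :
    Tendsto (fun N : ℕ => approxMeasure μ N (x, y)) atTop (𝓝 (μ (x, y))) := by
  by_cases hx : 0 < rowMass μ x
  · have hfl : ∀ c : ℝ, 0 ≤ c → Tendsto (fun N : ℕ => (⌊(N : ℝ) * c⌋₊ : ℝ) / N) atTop (𝓝 c) := by
      intro c hc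
      have h := (tendsto_nat_floor_mul_div_atTop hc).comp tendsto_natCast_atTop_atTop
      refine h.congr fun N => ?_
      simp only [Function.comp_apply, mul_comm c]
    have key : ∀ N : ℕ, 0 < N → approxMeasure μ N (x, y) =
        rowMass μ x * ((⌊(N : ℝ) * cdf μ x y⌋₊ : ℝ) / N - (⌊(N : ℝ) * cdfLt μ x y⌋₊ : ℝ) / N) := by
      intro N hN
      rw [approxMeasure_apply, if_pos hx, card_quantile_eq, card_quantile_le hμ0 hN hx, card_quantile_lt hμ0 hN hx,
        sub_div]
    have hlim : Tendsto (fun N : ℕ => rowMass μ x * ((⌊(N : ℝ) * cdf μ x y⌋₊ : ℝ) / N - (⌊(N : ℝ) * cdfLt μ x y⌋₊ : ℝ) / N))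
        atTop (𝓝 (rowMass μ x * (cdf μ x y - cdfLt μ x y))) :=
      ((hfl _ (cdf_nonneg hμ0 x y)).sub (hfl _ (cdfLt_nonneg hμ0 x y))).const_mul _
    have hval : rowMass μ x * (cdf μ x y - cdfLt μ x y) = μ (x, y) := by
      rw [cdf_sub_cdfLt, mul_div_cancel₀ _ hx.ne']
    rw [← hval]
    refine hlim.congr' ?_
    filter_upwards [eventually_gt_atTop 0] with N hN
    exact (key N hN).symm
  · have hzero : μ (x, y) = 0 :=
      le_antisymm ((le_rowMass hμ0 x y).trans (not_lt.1 hx)) (hμ0 _)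
    have hN : ∀ N : ℕ, approxMeasure μ N (x, y) = 0 := fun N => by rw [approxMeasure_apply, if_neg hx]
    rw [hzero]
    simp only [hN]
    exact tendsto_const_nhds

/-- The rows of positive mass carry the whole mass. [this work] -/
theorem sum_rowMass_posRow [LinearOrder α] [Fintype α] (hμ : IsFKGMeasure μ) : ∑ x : PosRow μ, rowMass μ x.1 = 1 := by
  have hsub : ∑ x : PosRow μ, rowMass μ x.1 = ∑ x ∈ univ.filter (fun x : α => 0 < rowMass μ x), rowMass μ x :=
    (Finset.sum_subtype (univ.filter fun x : α => 0 < rowMass μ x) (fun x => by simp) (fun x => rowMass μ x)).symm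
  rw [hsub, Finset.sum_filter_of_ne fun x _ hx => lt_of_le_of_ne (rowMass_nonneg hμ.nonneg x) (Ne.symm hx)]
  unfold rowMass
  rw [← Fintype.sum_prod_type]
  exact hμ.sum_eq_one

/-- The latent weight is a probability weight (for `N ≥ 1`). [this work] -/
theorem sum_latentWeight [LinearOrder α] [Fintype α] (hμ : IsFKGMeasure μ) {N : ℕ} (hN : 0 < N) :
    ∑ p : PosRow μ × Fin N, latentWeight μ N p = 1 := by
  rw [Fintype.sum_prod_type]
  have hinner : ∀ x : PosRow μ, ∑ k : Fin N, latentWeight μ N (x, k) = rowMass μ x.1 := by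
    intro x
    simp only [latentWeight, Finset.sum_const, Finset.card_univ, Fintype.card_fin, nsmul_eq_mul]
    have hNr : (N : ℝ) ≠ 0 := by exact_mod_cast hN.ne'
    field_simp
  simp only [hinner]
  exact sum_rowMass_posRow hμ

/-- **`E_n ≥ 0` for each approximating measure**: it is the push-forward of a product weight on the product of the two chains
`PosRow μ × Fin N` along a monotone map, so Lieb–Sahi's two-chain theorem (`ProductChains.sahiPositive_prodWeight_linearOrder`)
applies to the pulled-back family. [this work] -/
theorem sahiE_approxMeasure_nonneg [LinearOrder α] [Fintype α] [Nonempty β] (hμ : IsFKGMeasure μ) {N : ℕ} (hN : 0 < N)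
    {n : ℕ} (f : Fin n → α × β → ℝ) (hf : ∀ i z, 0 ≤ f i z) (hmono : ∀ i, Monotone (f i)) :
    0 ≤ sahiE (approxMeasure μ N) n f := by
  haveI : Nonempty (PosRow μ) := by
    by_contra h
    haveI : IsEmpty (PosRow μ) := not_nonempty_iff.1 h
    have h1 := sum_latentWeight hμ hN
    simp at h1
  haveI : Nonempty (Fin N) := ⟨⟨0, hN⟩⟩
  unfold approxMeasure
  rw [sahiE_pushWeight]
  have hW : latentWeight μ N = fun p : PosRow μ × Fin N => (fun x : PosRow μ => rowMass μ x.1) p.1 * (fun _ : Fin N => 1 / (N : ℝ)) p.2 :=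
    rfl
  rw [hW]
  refine ProductChains.sahiPositive_prodWeight_linearOrder (fun x : PosRow μ => rowMass μ x.1) (fun _ : Fin N => 1 / (N : ℝ))
    (fun x => x.2.le) ?_ (fun _ => by positivity) ?_ n (fun i => f i ∘ latentMap μ N) (fun i z => hf i _)
    (fun i => (hmono i).comp (latentMap_monotone hμ N))
  · exact sum_rowMass_posRow hμ
  · simp only [Finset.sum_const, Finset.card_univ, Fintype.card_fin, nsmul_eq_mul, one_div]
    exact mul_inv_cancel₀ (by exact_mod_cast hN.ne')

/-- **SAHI'S CONJECTURE 5 HOLDS FOR EVERY FKG MEASURE ON A PRODUCT OF TWO FINITE CHAINS, AT EVERY ORDER.**  For finite chains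
`α, β`, a probability weight `μ` on `α × β` satisfying the FKG lattice condition, and nonnegative monotone `f_0,…,f_{n−1}`:
`E_n^μ(f_0,…,f_{n−1}) ≥ 0`.  Proof: the conditional law of the second coordinate is stochastically nondecreasing in the first
(`tail_mul_row_le`), so `μ` is the limit of push-forwards of product weights on `(rows) × Fin N` along the monotone quantile couplings
(`latentMap_monotone`, `tendsto_approxMeasure`); each approximant has `E_n ≥ 0` by Lieb–Sahi's two-chain theorem, and `E_n` is
continuous in the weight. [this work] -/
theorem sahiPositive_of_isFKGMeasure_prod [LinearOrder α] [Fintype α] [Nonempty β] (hμ : IsFKGMeasure μ) (n : ℕ) :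
    SahiPositive μ n := by
  intro f hf hmono
  have hcont := (Literature.Probability.Percolation.BHK2006.continuous_sahiE n f).tendsto μ
  have hlim : Tendsto (fun N : ℕ => approxMeasure μ N) atTop (𝓝 μ) := by
    rw [tendsto_pi_nhds]
    rintro ⟨x, y⟩
    exact tendsto_approxMeasure hμ.nonneg x y
  refine ge_of_tendsto (hcont.comp hlim) ?_
  filter_upwards [eventually_gt_atTop 0] with N hN
  exact sahiE_approxMeasure_nonneg hμ hN f hf hmono

end FKG



end SahiTwoChain

end Summit.CriticalPhenomena.PercolationContinuityZ3.Theorems
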